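import Mathlib
import HarnessLib
import Summits.Ventures.LatticeQCDFlow.Scaling.AutoregressiveGaugeAllClosingOptimalOrder
import Summits.Ventures.LatticeQCDFlow.Scaling.AbelianHolonomyNonDetermination
import Summits.Ventures.LatticeQCDFlow.Scaling.PlaquetteTwoWeightConstant

/-!
# LatticeQCDFlow / Scaling — among all ranked structures the OPTIMAL ones maximise the exact cold escape rate:
# every covered plaquette buys exactly a factor `M/c ≥ 1`

HONEST FRAMING: exact (Metropolis-corrected) sampling algorithms for lattice gauge theory;
figures of merit are autocorrelation/cost numbers at stated couplings and volumes; no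
continuum-physics claim.

Venture `LatticeQCDFlow` (cell pub-lqcd), topic `Scaling`, FANOUT row 30 (lean-1, GEN-28) — OUR WORK on
THEORY-2.md §4 row C5.  `AutoregressiveGaugeHeatBathColdExact` ∕ `…UniformRateExact`: the exact uniform
convergence rate gap of the one-plaquette heat bath along a ranked `(B, t)` is `A_B(cold) = Z/(c^{#B} M^{#Bᶜ})`.
Pure arithmetic on that number (`c = ∫ w ≤ M`; `#B + #Bᶜ = #P`):

* **`coldRate_eq_mul_pow`** — `Z/(c^{#B} M^{#Bᶜ}) = (Z/M^{#P})·(M/c)^{#B}`: every covered plaquette multiplies the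
  exact rate gap by exactly `M/c ≥ 1` (`integral_le_of_le`: `c ≤ M`);
* **`coldRate_mono`** — hence the rate is monotone in the number of covered plaquettes: `#B ≤ #B'` implies
  `Z/(c^{#B} M^{#Bᶜ}) ≤ Z/(c^{#B'} M^{#B'ᶜ})`;
* **`coldRate_le_optimal`** — a RANKED structure has `#B ≤ (d−1)(L^d−1)`
  (`AbelianHolonomyNonDetermination.card_le_of_ranked`), so its exact rate gap is at most the common value of
  the OPTIMAL structures, `Z·(M/c)^{(d−1)(L^d−1)}/M^{#P} = Z/(c^{(d−1)(L^d−1)} M^{k_min(d,L)})`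
  (`#P = k_min + (d−1)(L^d−1)`, `AutoregressiveGaugeAllClosingOptimalOrder.card_plaquette_eq_kmin_add`): THE OPTIMAL
  STRUCTURES ARE OPTIMAL FOR THE EXACT UNIFORM RATE, not only for the coverage count; with equality iff
  `#B = (d−1)(L^d−1)` when `c < M` (non-constant `w`), **`coldRate_lt_optimal_of_lt`**.

No `def`, no `sorry`, nothing cited as a fact beyond the tree.
-/

noncomputable section

namespace Summit.Ventures.LatticeQCDFlow.Theory2.Autoregressive

open MeasureTheory Finset
open Literature.MathematicalPhysics.QuantumFieldTheory Literature.MathematicalPhysics.QuantumLattice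

variable {d L : ℕ} [NeZero L]

/-! ## §1 Arithmetic of the exact rate -/

/-- `Z/(c^b M^k) = (Z/M^{b+k})·(M/c)^b` (`c, M > 0`). [ours] -/
theorem coldRate_eq_mul_pow {Z c M : ℝ} (hc : 0 < c) (hM : 0 < M) (b k : ℕ) :
    Z / (c ^ b * M ^ k) = Z / M ^ (b + k) * (M / c) ^ b := by
  rw [div_pow, pow_add]
  field_simp

/-- **Monotone in the coverage**: with `b + k = b' + k' = P`, `b ≤ b'` and `c ≤ M`:
`Z/(c^b M^k) ≤ Z/(c^{b'} M^{k'})` (`Z ≥ 0`). [ours] -/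
theorem coldRate_mono {Z c M : ℝ} (hZ : 0 ≤ Z) (hc : 0 < c) (hcM : c ≤ M) {b k b' k' : ℕ}
    (hP : b + k = b' + k') (hb : b ≤ b') :
    Z / (c ^ b * M ^ k) ≤ Z / (c ^ b' * M ^ k') := by
  have hM : 0 < M := hc.trans_le hcM
  rw [coldRate_eq_mul_pow hc hM b k, coldRate_eq_mul_pow hc hM b' k', hP]
  exact mul_le_mul_of_nonneg_left (pow_le_pow_right₀ ((one_le_div hc).2 hcM) hb)
    (div_nonneg hZ (pow_nonneg hM.le _))

/-- … and STRICTLY if `b < b'`, `c < M`, `Z > 0`. [ours] -/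
theorem coldRate_strictMono {Z c M : ℝ} (hZ : 0 < Z) (hc : 0 < c) (hcM : c < M) {b k b' k' : ℕ}
    (hP : b + k = b' + k') (hb : b < b') :
    Z / (c ^ b * M ^ k) < Z / (c ^ b' * M ^ k') := by
  have hM : 0 < M := hc.trans hcM
  rw [coldRate_eq_mul_pow hc hM b k, coldRate_eq_mul_pow hc hM b' k', hP]
  exact mul_lt_mul_of_pos_left (pow_lt_pow_right₀ ((one_lt_div hc).2 hcM) hb)
    (div_pos hZ (pow_pos hM _))

/-! ## §2 The optimal structures maximise the exact rate among ranked structures -/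

section Haar

variable {G : Type*} [Group G] [TopologicalSpace G] [IsTopologicalGroup G]
  [CompactSpace G] [MeasurableSpace G] [BorelSpace G]

/-- `c = ∫ w dHaar ≤ M` when `w ≤ M`. [ours] -/
theorem integral_weight_le {w : G → ℝ} (hw : Continuous w) {M : ℝ} (hM : ∀ g, w g ≤ M) :
    ∫ g, w g ∂(haarProbability G) ≤ M := by
  have h := integral_mono (Literature.Probability.LatticeModels.integrable_of_continuous_compactSpace _ hw)
    (integrable_const (μ := haarProbability G) M) hM
  rwa [integral_const, smul_eq_mul, probReal_univ, one_mul] at h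

/-- **AMONG RANKED STRUCTURES THE OPTIMAL ONES MAXIMISE THE EXACT COLD ESCAPE RATE.**  `L ≥ 2`; `w` continuous,
`0 < m ≤ w ≤ M`; `(B, t, rank)` ranked; `Z ≥ 0` any real (the partition function in the application).  Then
`Z/(c^{#B} M^{#Bᶜ}) ≤ Z/(c^{(d−1)(L^d−1)} M^{k_min(d,L)})`, the common exact rate of the optimal structures. [ours] -/
theorem coldRate_le_optimal (hL : 2 ≤ L) {w : G → ℝ} (hw : Continuous w) {m M : ℝ} (hm0 : 0 < m)
    (hm : ∀ g, m ≤ w g) (hM : ∀ g, w g ≤ M)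
    (B : Finset (Plaquette d L)) (t : Plaquette d L → Edge d L)
    (ht : ∀ p ∈ B, t p ∈ ({(p.1, p.2.1.1), (p.1.shift p.2.1.1, p.2.1.2),
        (p.1.shift p.2.1.2, p.2.1.1), (p.1, p.2.1.2)} : Finset (Edge d L)))
    (rank : Plaquette d L → ℕ)
    (hrank : ∀ p ∈ B, ∀ p' ∈ B, p ≠ p' → t p ∈ ({(p'.1, p'.2.1.1), (p'.1.shift p'.2.1.1, p'.2.1.2),
        (p'.1.shift p'.2.1.2, p'.2.1.1), (p'.1, p'.2.1.2)} : Finset (Edge d L)) → rank p < rank p')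
    {Z : ℝ} (hZ : 0 ≤ Z) :
    Z / ((∫ g, w g ∂(haarProbability G)) ^ B.card * M ^ (Finset.univ \ B).card) ≤
      Z / ((∫ g, w g ∂(haarProbability G)) ^ ((d - 1) * (L ^ d - 1)) *
        M ^ ((d - 1) * (d - 2) / 2 * L ^ d + (d - 1))) := by
  classical
  have hw0 : ∀ g, 0 < w g := fun g => hm0.trans_le (hm g)
  have hc : 0 < ∫ g, w g ∂(haarProbability G) := haarProbability_integral_pos_of_continuous_pos hw hw0
  have hcM : ∫ g, w g ∂(haarProbability G) ≤ M := integral_weight_le hw hM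
  have hle : B.card ≤ (d - 1) * (L ^ d - 1) := card_le_of_ranked hL B t ht rank hrank
  have hP : B.card + (Finset.univ \ B).card =
      (d - 1) * (L ^ d - 1) + ((d - 1) * (d - 2) / 2 * L ^ d + (d - 1)) := by
    rw [Finset.card_sdiff_of_subset (Finset.subset_univ B), Finset.card_univ, card_plaquette_eq_kmin_add,
      Nat.add_sub_cancel' (hle.trans (Nat.le_add_left _ _))]
    ring
  exact coldRate_mono hZ hc hcM hP hle

/-- **… STRICTLY for a non-full ranked structure** when `w` is not constant (`∫ w < M`) and `Z > 0`: only the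
optimal structures attain the maximal exact rate (any `B` with `#B < (d−1)(L^d−1)`, ranked or not). [ours] -/
theorem coldRate_lt_optimal_of_lt {w : G → ℝ} (hw : Continuous w) {m M : ℝ} (hm0 : 0 < m)
    (hm : ∀ g, m ≤ w g) (hcM : ∫ g, w g ∂(haarProbability G) < M)
    (B : Finset (Plaquette d L)) (hlt : B.card < (d - 1) * (L ^ d - 1)) {Z : ℝ} (hZ : 0 < Z) :
    Z / ((∫ g, w g ∂(haarProbability G)) ^ B.card * M ^ (Finset.univ \ B).card) <
      Z / ((∫ g, w g ∂(haarProbability G)) ^ ((d - 1) * (L ^ d - 1)) *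
        M ^ ((d - 1) * (d - 2) / 2 * L ^ d + (d - 1))) := by
  classical
  have hw0 : ∀ g, 0 < w g := fun g => hm0.trans_le (hm g)
  have hc : 0 < ∫ g, w g ∂(haarProbability G) := haarProbability_integral_pos_of_continuous_pos hw hw0
  have hle : B.card ≤ (d - 1) * (L ^ d - 1) := hlt.le
  have hP : B.card + (Finset.univ \ B).card =
      (d - 1) * (L ^ d - 1) + ((d - 1) * (d - 2) / 2 * L ^ d + (d - 1)) := by
    rw [Finset.card_sdiff_of_subset (Finset.subset_univ B), Finset.card_univ, card_plaquette_eq_kmin_add,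
      Nat.add_sub_cancel' (hle.trans (Nat.le_add_left _ _))]
    ring
  exact coldRate_strictMono hZ hc hcM hP hlt

end Haar

end Summit.Ventures.LatticeQCDFlow.Theory2.Autoregressive

end
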